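import Literature.Analysis.FluidPDE.CriticalRegularityPathSpace
import Literature.Analysis.FluidPDE.AlbrittonBlowupCriterionContinuation
import HarnessLib

/-!
# Albritton's Theorem 1.1 over Albritton's own solution class

Proof-only sibling of `Literature/Analysis/FluidPDE/CriticalRegularity.lean` (named fact
`Literature.Analysis.FluidPDE.albritton_besov_blowup` = D. Albritton, *Blow-up criteria for the
Navier–Stokes equations in non-endpoint critical Besov spaces*, Anal. PDE 11 (2018) 1415–1456 =
arXiv:1612.04439, **Thm. 1.1**), of `CriticalRegularityPathSpace.lean` (the same analysis for GKP's
Theorem 1, `gkp_besov_blowup`) and of `AlbrittonBlowupCriterionContinuation.lean` (the continuation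
form of the vendored fact). No definition, no named fact; nothing accepted is restated or changed.
It records, machine-checked, what separates the vendored `albritton_besov_blowup` from the printed
Theorem 1.1 (the verdict of the fact's prove seat, 2026-08-15).

## What is printed and what is vendored

In print (arXiv:1612.04439, p. 4), Theorem 1.1 reads: *let `3 < p, q < ∞` and
`u₀ ∈ Ḃ^{s_p}_{p,q}(ℝ³)` be divergence free; suppose `u` is **the** mild solution of the
Navier–Stokes equations on `ℝ³ × [0, T*)` with initial data `u₀` and maximal time of existence
`T*(u₀)`; if `T* < ∞` then `lim_{t ↑ T*} ‖u(t)‖_{Ḃ^{s_p}_{p,q}} = ∞`*, where "the mild solution" and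
`T*(u₀)` are those of Thm. 4.2 (p. 20): `u` solves the Duhamel equation
`u(t) = e^{tΔ}u₀ - ∫₀ᵗ e^{(t-s)Δ} ℙ div (u ⊗ u) ds` and is **the unique mild solution in the class
`C([0,T]; Ḃ^{s_p}_{p,q}) ∩ L̃¹_T Ḃ^{s_p+2}_{p,q} ∩ L̃^∞_T Ḃ^{s_p}_{p,q}`** (first displayed class of
Thm. 4.2 — Gallagher–Koch–Planchon's path space `𝓛^{1:∞}_{p,q}(T)`, GKP 2016, (1.5)–(1.6)) **and the
unique mild solution in `K̊_p(Q_T) ∩ K̊_∞(Q_T) ∩ C((0,T]; L^p ∩ L^∞)`** (second displayed class), for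
all `0 < T < T*(u₀)`; moreover (Thm. 4.2 (i)) `T* < ∞` forces `lim_{t ↑ T*} ‖u(t)‖_{L^{p₀}} = ∞` for
every `p₀ ∈ [p, ∞]`.

The vendored `albritton_besov_blowup` quantifies instead over the tree's class
`IsMaximalBesovMildSolution (-1 + 3/p) p q T ν u U` of `CriticalRegularity.lean`: a *duality-form*
mild solution from its own initial slice (`IsMildNSSolutionOn`, junk-valued Bochner integrals),
continuous in `Ḃ^{s_p}_{p,q}` through the distributions of its slices, in Kato's class **`K_∞` only**
(`MemKatoClassOn`: `sup_{0<τ<t} √τ ‖u(τ)‖_∞ < ∞` for `t < T`, `→ 0` at `0⁺`), with **no extension in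
that class** past `T`. This class is neither of Albritton's two uniqueness classes (it asks neither
`L̃¹_T Ḃ^{s_p+2}_{p,q}` nor `K̊_p` nor `C((0,T]; L^p)`), and it is not a published uniqueness class
(audits: `GKPRegularityPersistence.lean`, `GKPCriticalElements.lean` §"GKP's solution class versus
the tree's class": continuity in `Ḃ^{s_p}_{p,q}` alone is not a uniqueness class, Fujii 2026,
Thm. 1.2; Kato-type uniqueness theorems use an integrability at `t = 0` that `K_∞` does not supply,
Miura 2005, Thm. 2.3). Note also that `K_∞` and bounded `Ḃ^{s_p}_{p,q}` norms bound the Duhamel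
pairing `∫ ⟪u τ, (u τ · ∇) e^{ν(t-τ)Δ}φ⟫` of `IsMildNSSolutionFrom` only by `‖u τ‖²_∞ ‖∇e^{ν(t-τ)Δ}φ‖₁
= o(1/τ)` as `τ → 0⁺`, which is not integrable in general, whereas in Albritton's class
`K̊_p ∩ K̊_∞` it is `O(τ^{-1+3/(2p)}) ∈ L¹(0, t)` (Hölder with `‖u τ‖_p ≤ C τ^{s_p/2}`; Albritton 2018,
Lemma 4.1): the integrability class that the docstring of `IsMildNSSolutionBetween` demands is part of
the printed class, not of the tree's.

## What this file proves

* **Tree ⇒ print, no identification needed** (`§ LinftyBlowup`): a Besov mild solution on `[0, T)`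
  whose `L^∞` norm tends to `∞` as `t ↑ T` — which is what Thm. 4.2 (i) prints for `NS(u₀)` at
  `T = T*(u₀) < ∞` — is maximal in the tree's sense
  (`IsBesovMildSolutionOn.isMaximalBesovMildSolution_of_tendsto_eLpNorm_top`: an extension lies in
  `K_∞` past `T`, so `u` would be essentially bounded near `T`), hence the vendored fact yields the
  printed conclusion for it (`albritton_besov_blowup.tendsto_of_tendsto_eLpNorm_top`). So the vendored
  statement is **at least as strong as** Theorem 1.1 (function-valued data, any viscosity).
* **Print ⇒ tree needs the identification** (`§ PathSpace`): with "Albritton/GKP solution on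
  `[0, T)`" := Besov mild solution lying in `𝓛^{1:∞}_{p,q}[T' < T]` (`MemGKPPathSpace`, the first
  uniqueness class of Thm. 4.2 on every `[0, T']`, `T' < T`) and "`T = T*(u₀)`" := no such solution on
  a longer interval extends it, Theorem 1.1 over that class is the hypothesis `hP` of
  `albritton_besov_blowup_of_pathSpaceTendsto`, and the vendored fact follows from `hP` **plus** the
  identification `hId` "every `IsBesovMildSolutionOn` solution lies in `𝓛^{1:∞}_{p,q}[T' < T]`" — the
  standing design assumption of `CriticalRegularity.lean` ("Kato's class … in which mild solutions
  are unique"), **not** a published result and not asserted here. Conversely the vendored fact gives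
  `hP` back under `hId` (`pathSpaceTendsto_of_albritton_besov_blowup`), whence
  `albritton_besov_blowup_iff_pathSpaceTendsto : hId → (albritton_besov_blowup ↔ hP)`.
* `pathSpaceBlowup_of_pathSpaceTendsto`: over the path-space class Albritton's `lim` form implies
  GKP's `limsup` form (the hypothesis `hP` of `gkp_besov_blowup_of_pathSpaceBlowup`), as Thm. 1.1
  strengthens GKP 2016, Thm. 1.

**Verdict recorded by the prove seat.** `albritton_besov_blowup` = Theorem 1.1 over the path-space
class (`hP`) + the unprinted identification (`hId`); without `hId` only "vendored ⇒ printed" is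
available. The statement is therefore *stronger than its source* (mis-stated in the sense of the
tree's conventions, exactly as `gkp_regularity_persistence`, `gkp_exists_criticalElement`,
`gkp_criticalElement_tendsto_zero` of `GKPCriticalElements.lean`); nothing here asserts that it is
false. Its faithful form is `hP` below (to be cited as Albritton2018, Thm. 1.1 with Thm. 4.2), not
declared as a named fact in this proof-only file (D-0026).

## References

* D. Albritton, *Blow-up criteria for the Navier–Stokes equations in non-endpoint critical Besov
  spaces*, Anal. PDE 11 (2018) 1415–1456 = arXiv:1612.04439: Thm. 1.1 (p. 4); Thm. 4.2 with its two
  uniqueness classes and (i) (p. 20); Lemma 4.1 (p. 19). [cite: Albritton2018, Thm. 1.1]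
* I. Gallagher, G. S. Koch, F. Planchon, *Blow-up of critical Besov norms at a potential
  Navier–Stokes singularity*, Comm. Math. Phys. 343 (2016) 39–82 = arXiv:1407.4156: (1.3), (1.5),
  (1.6), Thm. 1. [cite: GKP2016, (1.6)]
* M. Fujii, *Sharp non-uniqueness for the Navier–Stokes equations in scaling critical spaces*,
  arXiv:2602.19846 (2026), Thm. 1.2. [cite: Fujii2026, Thm. 1.2]
* H. Miura, *Remark on uniqueness of mild solutions to the Navier–Stokes equations*, J. Funct.
  Anal. 218 (2005) 110–129, Thm. 2.3. [cite: Miura2005, Thm. 2.3]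
-/

noncomputable section

open MeasureTheory TemperedDistribution Set Function Filter
open _root_.Topology
open scoped SchwartzMap ENNReal NNReal

namespace Literature.Analysis.FluidPDE

/-! ## Vendored ⇒ printed: `L^∞` blow-up at `T` makes a Besov mild solution maximal in the tree -/

section LinftyBlowup

variable {s : ℝ} {p q : ℝ≥0∞} [Fact (1 ≤ p)] {T ν : ℝ}
  {u : ℝ → EuclideanSpace ℝ (Fin 3) → EuclideanSpace ℝ (Fin 3)}
  {U : ℝ → 𝓢'(EuclideanSpace ℝ (Fin 3), EuclideanSpace ℂ (Fin 3))}

/-- **Unbounded Kato quantity ⇒ maximal in the tree's class.** A Besov mild solution `(u, U)` on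
`[0, T)` whose Kato quantity `√τ ‖u(τ)‖_{L^∞}` is unbounded on `(0, T)` has no extension in the
tree's class `IsBesovMildSolutionOn` past `T`: an extension `(v, V)` on `[0, T')`, `T' > T`, lies in
`K_∞` on `[0, T')` (`MemKatoClassOn`), so `sup_{0<τ<T} √τ ‖v(τ)‖_∞ < ∞`, while `v τ = u τ` a.e. for
`τ < T` (`eLpNorm_congr_ae`). This is the mechanism by which Albritton's characterisation of
`T*(u₀)` (Thm. 4.2 (i): `lim_{t ↑ T*} ‖u(t)‖_{L^∞} = ∞`) makes `NS(u₀)` maximal in the tree's sense.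
[cite: Albritton2018, Thm. 4.2 (i)] -/
theorem IsBesovMildSolutionOn.isMaximalBesovMildSolution_of_forall_exists_lt
    (hu : IsBesovMildSolutionOn s p q T ν u U)
    (hblow : ∀ K : ℝ≥0, ∃ t ∈ Ioo 0 T,
      (K : ℝ≥0∞) < ENNReal.ofReal (Real.sqrt t) * eLpNorm (u t) ∞ volume) :
    IsMaximalBesovMildSolution s p q T ν u U where
  isBesovMildSolutionOn := hu
  not_extendable := by
    rintro ⟨T', hT', v, V, hv, hvu⟩
    have hS : (⨆ τ ∈ Ioo 0 T, ENNReal.ofReal (Real.sqrt τ) * eLpNorm (v τ) ∞ volume) ≠ ∞ :=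
      (hv.memKatoClassOn.1 T hT').ne
    obtain ⟨t, ht, hlt⟩ :=
      hblow (⨆ τ ∈ Ioo 0 T, ENNReal.ofReal (Real.sqrt τ) * eLpNorm (v τ) ∞ volume).toNNReal
    rw [ENNReal.coe_toNNReal hS] at hlt
    have hae : v t =ᵐ[volume] u t := hvu t ⟨ht.1.le, ht.2⟩
    have hle : ENNReal.ofReal (Real.sqrt t) * eLpNorm (u t) ∞ volume ≤
        ⨆ τ ∈ Ioo 0 T, ENNReal.ofReal (Real.sqrt τ) * eLpNorm (v τ) ∞ volume := by
      rw [← eLpNorm_congr_ae hae]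
      exact le_iSup₂ (f := fun (τ : ℝ) (_ : τ ∈ Ioo 0 T) =>
        ENNReal.ofReal (Real.sqrt τ) * eLpNorm (v τ) ∞ volume) t ht
    exact absurd hlt (not_lt.2 hle)

/-- **`L^∞` blow-up at `T` ⇒ maximal in the tree's class.** A Besov mild solution `(u, U)` on
`[0, T)`, `0 < T`, with `‖u(t)‖_{L^∞} → ∞` as `t ↑ T` — Albritton's characterisation of the maximal
time, Thm. 4.2 (i) with `p₀ = ∞`: "`lim_{t ↑ T*} ‖u(·,t)‖_{L^{p₀}} = ∞`" — is a maximal Besov mild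
solution of the tree (`IsMaximalBesovMildSolution`): on `(T/2, T)` the weight `√t ≥ √(T/2) > 0`, so
the Kato quantity is unbounded and
`IsBesovMildSolutionOn.isMaximalBesovMildSolution_of_forall_exists_lt` applies. In particular
`NS(u₀)` with `T*(u₀) < ∞` (function-valued datum) is maximal in the tree's sense with lifespan
`T*(u₀)`. [cite: Albritton2018, Thm. 4.2 (i)] -/
theorem IsBesovMildSolutionOn.isMaximalBesovMildSolution_of_tendsto_eLpNorm_top
    (hu : IsBesovMildSolutionOn s p q T ν u U) (hT : 0 < T)
    (hblow : Tendsto (fun t => eLpNorm (u t) ∞ volume) (𝓝[<] T) (𝓝 ∞)) :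
    IsMaximalBesovMildSolution s p q T ν u U := by
  refine hu.isMaximalBesovMildSolution_of_forall_exists_lt fun K => ?_
  -- the positive lower bound `c = √(T/2)` of the weight `√t` on `(T/2, T)`
  obtain ⟨c, hc, hcT⟩ : ∃ c : ℝ≥0, c ≠ 0 ∧ (c : ℝ≥0∞) = ENNReal.ofReal (Real.sqrt (T / 2)) :=
    ⟨(Real.sqrt (T / 2)).toNNReal, (Real.toNNReal_pos.2 (Real.sqrt_pos.2 (half_pos hT))).ne', rfl⟩
  rw [ENNReal.tendsto_nhds_top_iff_nnreal] at hblow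
  obtain ⟨t, hKt, ht⟩ := ((hblow (K / c)).and (Ioo_mem_nhdsLT (half_lt_self hT))).exists
  refine ⟨t, ⟨(half_pos hT).trans ht.1, ht.2⟩, ?_⟩
  have hct : (c : ℝ≥0∞) ≤ ENNReal.ofReal (Real.sqrt t) :=
    hcT.trans_le (ENNReal.ofReal_le_ofReal (Real.sqrt_le_sqrt ht.1.le))
  calc (K : ℝ≥0∞) = ((K / c : ℝ≥0) : ℝ≥0∞) * (c : ℝ≥0∞) := by
        rw [← ENNReal.coe_mul, div_mul_cancel₀ K hc]
    _ < eLpNorm (u t) ∞ volume * (c : ℝ≥0∞) :=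
        ENNReal.mul_lt_mul_left (ENNReal.coe_ne_zero.2 hc) ENNReal.coe_ne_top hKt
    _ ≤ eLpNorm (u t) ∞ volume * ENNReal.ofReal (Real.sqrt t) := by gcongr
    _ = ENNReal.ofReal (Real.sqrt t) * eLpNorm (u t) ∞ volume := mul_comm _ _

/-- **`L^∞` blow-up at `T` ⇒ no extension in Albritton's (GKP's) class either**: a Besov mild
solution with `‖u(t)‖_{L^∞} → ∞` as `t ↑ T`, `0 < T`, is not extended past `T` by any Besov mild
solution lying in the path space `𝓛^{1:∞}_{p,q}[T'' < T']` (`MemGKPPathSpace`; such an extension is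
in particular one in the tree's class). With the uniqueness of Thm. 4.2 in that class this is the
printed "`T = T*(u₀)`" (Albritton 2018, Thm. 4.2 (i)). [cite: Albritton2018, Thm. 4.2 (i)] -/
theorem IsBesovMildSolutionOn.not_exists_extension_pathSpace_of_tendsto_eLpNorm_top
    (hu : IsBesovMildSolutionOn s p q T ν u U) (hT : 0 < T)
    (hblow : Tendsto (fun t => eLpNorm (u t) ∞ volume) (𝓝[<] T) (𝓝 ∞)) :
    ¬ ∃ T' > T, ∃ (v : ℝ → EuclideanSpace ℝ (Fin 3) → EuclideanSpace ℝ (Fin 3))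
        (V : ℝ → 𝓢'(EuclideanSpace ℝ (Fin 3), EuclideanSpace ℂ (Fin 3))),
      (IsBesovMildSolutionOn s p q T' ν v V ∧ MemGKPPathSpace p q T' V) ∧
        ∀ t ∈ Ico 0 T, v t =ᵐ[volume] u t :=
  (hu.isMaximalBesovMildSolution_of_tendsto_eLpNorm_top hT hblow).not_exists_extension_pathSpace

/-- **The vendored fact contains Theorem 1.1 for every Besov mild solution whose `L^∞` norm blows
up — no identification needed in this direction.** Assume `albritton_besov_blowup`. Let `ν > 0`,
`3 < p, q < ∞`, `0 < T`, and let `(u, U)` be a Besov mild solution on `[0, T)` of the class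
`(s_p, p, q)` with `‖u(t)‖_{L^∞} → ∞` as `t ↑ T` (for the printed `NS(u₀)` with `T = T*(u₀) < ∞`
this is Thm. 4.2 (i)). Then `‖U t‖_{Ḃ^{s_p}_{p,q}} → ∞` as `t ↑ T` — the conclusion of Theorem 1.1:
`(u, U)` is maximal in the tree's sense
(`IsBesovMildSolutionOn.isMaximalBesovMildSolution_of_tendsto_eLpNorm_top`) and the vendored fact
applies. Hence `albritton_besov_blowup` is at least as strong as the printed theorem.
[cite: Albritton2018, Thm. 1.1] -/
theorem albritton_besov_blowup.tendsto_of_tendsto_eLpNorm_top (h : albritton_besov_blowup) {ν : ℝ}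
    (hν : 0 < ν) {p q : ℝ≥0∞} [Fact (1 ≤ p)] (hp₃ : 3 < p) (hp : p < ∞) (hq₃ : 3 < q) (hq : q < ∞)
    {T : ℝ} (hT : 0 < T) {u : ℝ → EuclideanSpace ℝ (Fin 3) → EuclideanSpace ℝ (Fin 3)}
    {U : ℝ → 𝓢'(EuclideanSpace ℝ (Fin 3), EuclideanSpace ℂ (Fin 3))}
    (hu : IsBesovMildSolutionOn (-1 + 3 / p.toReal) p q T ν u U)
    (hblow : Tendsto (fun t => eLpNorm (u t) ∞ volume) (𝓝[<] T) (𝓝 ∞)) :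
    Tendsto (fun t => FunctionSpaces.eHomBesovNorm (-1 + 3 / p.toReal) p q (U t)) (𝓝[<] T) (𝓝 ∞) :=
  h hν hp₃ hp hq₃ hq hT (hu.isMaximalBesovMildSolution_of_tendsto_eLpNorm_top hT hblow)

end LinftyBlowup

/-! ## Printed ⇒ vendored: Theorem 1.1 over the path-space class, and the identification -/

section PathSpace

/-- **`albritton_besov_blowup` = Theorem 1.1 over Albritton's class `𝓛^{1:∞}_{p,q}[T' < T]` + the
identification of the tree's class with `NS(u₀)`.** Hypothesis `hP` is Albritton 2018, Thm. 1.1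
transported to the first uniqueness class of Thm. 4.2: with "Albritton solution on `[0, T)`" :=
Besov mild solution of the class `(s_p, p, q)` lying in `𝓛^{1:∞}_{p,q}[T' < T]` (`MemGKPPathSpace`,
i.e. `C([0,T']; Ḃ^{s_p}_{p,q}) ∩ L̃¹_{T'} Ḃ^{s_p+2}_{p,q} ∩ L̃^∞_{T'} Ḃ^{s_p}_{p,q}` for every
`T' < T` — the restriction of `NS(u 0)` to `[0, T)`, `T ≤ T*`, by the uniqueness of Thm. 4.2) and
"`T = T*`" := no Albritton solution on a longer interval extends it, *every Albritton solution with
finite `T = T*` has `‖U t‖_{Ḃ^{s_p}_{p,q}} → ∞` as `t ↑ T`*, for all `3 < p, q < ∞` and (as everywhere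
in this file family) every viscosity `ν > 0` and function-valued solutions. Hypothesis `hId` is the
standing identification of `CriticalRegularity.lean` in the form of
`gkp_regularity_persistence_of_pathSpace` / `gkp_besov_blowup_of_pathSpaceBlowup` — every
`IsBesovMildSolutionOn` solution lies in the path space — which is **not** a published result and
is not asserted here. Together: a maximal solution of the tree lies in the path space by `hId` and
has no extension in the (smaller) path-space class
(`IsMaximalBesovMildSolution.not_exists_extension_pathSpace`), so `hP` applies.
[cite: Albritton2018, Thm. 1.1] -/
theorem albritton_besov_blowup_of_pathSpaceTendsto
    (hP : ∀ ⦃ν : ℝ⦄, 0 < ν → ∀ ⦃p q : ℝ≥0∞⦄ [Fact (1 ≤ p)], 3 < p → p < ∞ → 3 < q → q < ∞ →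
      ∀ ⦃T : ℝ⦄, 0 < T → ∀ ⦃u : ℝ → EuclideanSpace ℝ (Fin 3) → EuclideanSpace ℝ (Fin 3)⦄
        ⦃U : ℝ → 𝓢'(EuclideanSpace ℝ (Fin 3), EuclideanSpace ℂ (Fin 3))⦄,
        IsBesovMildSolutionOn (-1 + 3 / p.toReal) p q T ν u U → MemGKPPathSpace p q T U →
        (¬ ∃ T' > T, ∃ (v : ℝ → EuclideanSpace ℝ (Fin 3) → EuclideanSpace ℝ (Fin 3))
            (V : ℝ → 𝓢'(EuclideanSpace ℝ (Fin 3), EuclideanSpace ℂ (Fin 3))),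
            (IsBesovMildSolutionOn (-1 + 3 / p.toReal) p q T' ν v V ∧ MemGKPPathSpace p q T' V) ∧
              ∀ t ∈ Ico 0 T, v t =ᵐ[volume] u t) →
        Tendsto (fun t => FunctionSpaces.eHomBesovNorm (-1 + 3 / p.toReal) p q (U t)) (𝓝[<] T)
          (𝓝 ∞))
    (hId : ∀ ⦃ν : ℝ⦄, 0 < ν → ∀ ⦃p q : ℝ≥0∞⦄ [Fact (1 ≤ p)], 3 < p → p < ∞ → 3 < q → q < ∞ →
      ∀ ⦃T : ℝ⦄, 0 < T → ∀ ⦃u : ℝ → EuclideanSpace ℝ (Fin 3) → EuclideanSpace ℝ (Fin 3)⦄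
        ⦃U : ℝ → 𝓢'(EuclideanSpace ℝ (Fin 3), EuclideanSpace ℂ (Fin 3))⦄,
        IsBesovMildSolutionOn (-1 + 3 / p.toReal) p q T ν u U → MemGKPPathSpace p q T U) :
    albritton_besov_blowup := by
  intro ν hν p q _ hp₃ hp hq₃ hq T hT u U hmax
  exact hP hν hp₃ hp hq₃ hq hT hmax.isBesovMildSolutionOn
    (hId hν hp₃ hp hq₃ hq hT hmax.isBesovMildSolutionOn) hmax.not_exists_extension_pathSpace

/-- **Conversely, under the identification the vendored fact contains Theorem 1.1 over the
path-space class**: granted `hId`, an Albritton solution on `[0, T)` with no extension in the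
path-space class is maximal in the tree's sense
(`isMaximalBesovMildSolution_of_not_exists_extension_pathSpace`: an extension in the tree's class
would lie in the path space), so `albritton_besov_blowup` applies to it (Albritton 2018, Thm. 1.1,
with Thm. 4.2). [cite: Albritton2018, Thm. 1.1] -/
theorem pathSpaceTendsto_of_albritton_besov_blowup (h : albritton_besov_blowup)
    (hId : ∀ ⦃ν : ℝ⦄, 0 < ν → ∀ ⦃p q : ℝ≥0∞⦄ [Fact (1 ≤ p)], 3 < p → p < ∞ → 3 < q → q < ∞ →
      ∀ ⦃T : ℝ⦄, 0 < T → ∀ ⦃u : ℝ → EuclideanSpace ℝ (Fin 3) → EuclideanSpace ℝ (Fin 3)⦄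
        ⦃U : ℝ → 𝓢'(EuclideanSpace ℝ (Fin 3), EuclideanSpace ℂ (Fin 3))⦄,
        IsBesovMildSolutionOn (-1 + 3 / p.toReal) p q T ν u U → MemGKPPathSpace p q T U) :
    ∀ ⦃ν : ℝ⦄, 0 < ν → ∀ ⦃p q : ℝ≥0∞⦄ [Fact (1 ≤ p)], 3 < p → p < ∞ → 3 < q → q < ∞ →
      ∀ ⦃T : ℝ⦄, 0 < T → ∀ ⦃u : ℝ → EuclideanSpace ℝ (Fin 3) → EuclideanSpace ℝ (Fin 3)⦄
        ⦃U : ℝ → 𝓢'(EuclideanSpace ℝ (Fin 3), EuclideanSpace ℂ (Fin 3))⦄,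
        IsBesovMildSolutionOn (-1 + 3 / p.toReal) p q T ν u U → MemGKPPathSpace p q T U →
        (¬ ∃ T' > T, ∃ (v : ℝ → EuclideanSpace ℝ (Fin 3) → EuclideanSpace ℝ (Fin 3))
            (V : ℝ → 𝓢'(EuclideanSpace ℝ (Fin 3), EuclideanSpace ℂ (Fin 3))),
            (IsBesovMildSolutionOn (-1 + 3 / p.toReal) p q T' ν v V ∧ MemGKPPathSpace p q T' V) ∧
              ∀ t ∈ Ico 0 T, v t =ᵐ[volume] u t) →
        Tendsto (fun t => FunctionSpaces.eHomBesovNorm (-1 + 3 / p.toReal) p q (U t)) (𝓝[<] T)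
          (𝓝 ∞) := by
  intro ν hν p q _ hp₃ hp hq₃ hq T hT u U hu _ hnoext
  have hId' : ∀ ⦃T' : ℝ⦄, 0 < T' → ∀ ⦃v : ℝ → EuclideanSpace ℝ (Fin 3) → EuclideanSpace ℝ (Fin 3)⦄
      ⦃V : ℝ → 𝓢'(EuclideanSpace ℝ (Fin 3), EuclideanSpace ℂ (Fin 3))⦄,
      IsBesovMildSolutionOn (-1 + 3 / p.toReal) p q T' ν v V → MemGKPPathSpace p q T' V :=
    fun T' hT' v V hv => hId hν hp₃ hp hq₃ hq hT' hv
  exact h hν hp₃ hp hq₃ hq hT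
    (isMaximalBesovMildSolution_of_not_exists_extension_pathSpace hId' hT hu hnoext)

/-- **Under the identification, the vendored Theorem 1.1 and Theorem 1.1 over the path-space class
are equivalent** (`albritton_besov_blowup_of_pathSpaceTendsto` and
`pathSpaceTendsto_of_albritton_besov_blowup`; Albritton 2018, Thm. 1.1 with Thm. 4.2: the two
renderings of "`T = T*(u₀)`" coincide, `isMaximalBesovMildSolution_iff_pathSpace`).
[cite: Albritton2018, Thm. 1.1] -/
theorem albritton_besov_blowup_iff_pathSpaceTendsto
    (hId : ∀ ⦃ν : ℝ⦄, 0 < ν → ∀ ⦃p q : ℝ≥0∞⦄ [Fact (1 ≤ p)], 3 < p → p < ∞ → 3 < q → q < ∞ →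
      ∀ ⦃T : ℝ⦄, 0 < T → ∀ ⦃u : ℝ → EuclideanSpace ℝ (Fin 3) → EuclideanSpace ℝ (Fin 3)⦄
        ⦃U : ℝ → 𝓢'(EuclideanSpace ℝ (Fin 3), EuclideanSpace ℂ (Fin 3))⦄,
        IsBesovMildSolutionOn (-1 + 3 / p.toReal) p q T ν u U → MemGKPPathSpace p q T U) :
    albritton_besov_blowup ↔
      ∀ ⦃ν : ℝ⦄, 0 < ν → ∀ ⦃p q : ℝ≥0∞⦄ [Fact (1 ≤ p)], 3 < p → p < ∞ → 3 < q → q < ∞ →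
        ∀ ⦃T : ℝ⦄, 0 < T → ∀ ⦃u : ℝ → EuclideanSpace ℝ (Fin 3) → EuclideanSpace ℝ (Fin 3)⦄
        ⦃U : ℝ → 𝓢'(EuclideanSpace ℝ (Fin 3), EuclideanSpace ℂ (Fin 3))⦄,
        IsBesovMildSolutionOn (-1 + 3 / p.toReal) p q T ν u U → MemGKPPathSpace p q T U →
        (¬ ∃ T' > T, ∃ (v : ℝ → EuclideanSpace ℝ (Fin 3) → EuclideanSpace ℝ (Fin 3))
        (V : ℝ → 𝓢'(EuclideanSpace ℝ (Fin 3), EuclideanSpace ℂ (Fin 3))),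
        (IsBesovMildSolutionOn (-1 + 3 / p.toReal) p q T' ν v V ∧ MemGKPPathSpace p q T' V) ∧
        ∀ t ∈ Ico 0 T, v t =ᵐ[volume] u t) →
        Tendsto (fun t => FunctionSpaces.eHomBesovNorm (-1 + 3 / p.toReal) p q (U t)) (𝓝[<] T)
          (𝓝 ∞) :=
  ⟨fun h => pathSpaceTendsto_of_albritton_besov_blowup h hId,
    fun h => albritton_besov_blowup_of_pathSpaceTendsto h hId⟩

/-- **Over the path-space class, Albritton's `lim` form implies GKP's `limsup` form** (Albritton
2018, Thm. 1.1 "replaces the `limsup` condition in Gallagher–Koch–Planchon's criterion"): the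
hypothesis `hP` of `albritton_besov_blowup_of_pathSpaceTendsto` implies the hypothesis `hP` of
`gkp_besov_blowup_of_pathSpaceBlowup` (`CriticalRegularityPathSpace.lean`), since a function tending
to `∞` along the proper filter `𝓝[<] T` has `limsup = ∞` (`Filter.Tendsto.limsup_eq`).
[cite: Albritton2018, Thm. 1.1] -/
theorem pathSpaceBlowup_of_pathSpaceTendsto
    (hP : ∀ ⦃ν : ℝ⦄, 0 < ν → ∀ ⦃p q : ℝ≥0∞⦄ [Fact (1 ≤ p)], 3 < p → p < ∞ → 3 < q → q < ∞ →
      ∀ ⦃T : ℝ⦄, 0 < T → ∀ ⦃u : ℝ → EuclideanSpace ℝ (Fin 3) → EuclideanSpace ℝ (Fin 3)⦄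
        ⦃U : ℝ → 𝓢'(EuclideanSpace ℝ (Fin 3), EuclideanSpace ℂ (Fin 3))⦄,
        IsBesovMildSolutionOn (-1 + 3 / p.toReal) p q T ν u U → MemGKPPathSpace p q T U →
        (¬ ∃ T' > T, ∃ (v : ℝ → EuclideanSpace ℝ (Fin 3) → EuclideanSpace ℝ (Fin 3))
            (V : ℝ → 𝓢'(EuclideanSpace ℝ (Fin 3), EuclideanSpace ℂ (Fin 3))),
            (IsBesovMildSolutionOn (-1 + 3 / p.toReal) p q T' ν v V ∧ MemGKPPathSpace p q T' V) ∧
              ∀ t ∈ Ico 0 T, v t =ᵐ[volume] u t) →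
        Tendsto (fun t => FunctionSpaces.eHomBesovNorm (-1 + 3 / p.toReal) p q (U t)) (𝓝[<] T)
          (𝓝 ∞)) :
    ∀ ⦃ν : ℝ⦄, 0 < ν → ∀ ⦃p q : ℝ≥0∞⦄ [Fact (1 ≤ p)], 3 < p → p < ∞ → 3 < q → q < ∞ →
      ∀ ⦃T : ℝ⦄, 0 < T → ∀ ⦃u : ℝ → EuclideanSpace ℝ (Fin 3) → EuclideanSpace ℝ (Fin 3)⦄
        ⦃U : ℝ → 𝓢'(EuclideanSpace ℝ (Fin 3), EuclideanSpace ℂ (Fin 3))⦄,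
        IsBesovMildSolutionOn (-1 + 3 / p.toReal) p q T ν u U → MemGKPPathSpace p q T U →
        (¬ ∃ T' > T, ∃ (v : ℝ → EuclideanSpace ℝ (Fin 3) → EuclideanSpace ℝ (Fin 3))
            (V : ℝ → 𝓢'(EuclideanSpace ℝ (Fin 3), EuclideanSpace ℂ (Fin 3))),
            (IsBesovMildSolutionOn (-1 + 3 / p.toReal) p q T' ν v V ∧ MemGKPPathSpace p q T' V) ∧
              ∀ t ∈ Ico 0 T, v t =ᵐ[volume] u t) →
        limsup (fun t => FunctionSpaces.eHomBesovNorm (-1 + 3 / p.toReal) p q (U t)) (𝓝[<] T) = ∞ :=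
  fun _ hν _ _ _ hp₃ hp hq₃ hq _ hT _ _ hu hU hnoext =>
    (hP hν hp₃ hp hq₃ hq hT hu hU hnoext).limsup_eq

/-- **Corollary: under the identification, the vendored Albritton fact yields GKP's Theorem 1 over
the path-space class** (and hence, by `gkp_besov_blowup_of_pathSpaceBlowup`, the vendored
`gkp_besov_blowup` — which also follows identification-free from `gkp_besov_blowup_of_albritton`).
Recorded to tie the two path-space analyses together (Albritton 2018, Thm. 1.1 ⇒ GKP 2016, Thm. 1).
[cite: Albritton2018, Thm. 1.1] -/
theorem gkp_besov_blowup_of_albritton_of_identification (h : albritton_besov_blowup)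
    (hId : ∀ ⦃ν : ℝ⦄, 0 < ν → ∀ ⦃p q : ℝ≥0∞⦄ [Fact (1 ≤ p)], 3 < p → p < ∞ → 3 < q → q < ∞ →
      ∀ ⦃T : ℝ⦄, 0 < T → ∀ ⦃u : ℝ → EuclideanSpace ℝ (Fin 3) → EuclideanSpace ℝ (Fin 3)⦄
        ⦃U : ℝ → 𝓢'(EuclideanSpace ℝ (Fin 3), EuclideanSpace ℂ (Fin 3))⦄,
        IsBesovMildSolutionOn (-1 + 3 / p.toReal) p q T ν u U → MemGKPPathSpace p q T U) :
    gkp_besov_blowup :=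
  gkp_besov_blowup_of_pathSpaceBlowup
    (pathSpaceBlowup_of_pathSpaceTendsto (pathSpaceTendsto_of_albritton_besov_blowup h hId)) hId

end PathSpace

end Literature.Analysis.FluidPDE

end
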